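import Summits.AtomisticToContinuum.BoseEinsteinCondensation.Theorems.PeriodicIRBound.Negative.GroundOccupation

/-!
# Negative lemmas for crux `PeriodicIRBound` (stmt-AtomisticToContinuum-3972), IX: scalarisation — the crux is the finiteness of the infrared constants

Supports (does not close) stmt-AtomisticToContinuum-3972, route `BECGroundStateSOS`. Landed copy of
§18 of `Cruxes/PeriodicIRBound/Disproof.lean` (cycle 2, gen-2 disprover seat); all `sorry`-free,
axioms `propext`/`Classical.choice`/`Quot.sound`.

* §18 `irBoundFor_iff_irConstant` — with `irRatio v κ ρ N = max_{k ∈ window} γ_N(k)‖k‖_∞/(√ρ L_N)`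
  (`γ_N = groundOccupation`, file `GroundOccupation`) and
  `irConstant v κ ρ₀ = sup_{0<ρ<ρ₀} limsup_N irRatio v κ ρ N ∈ [0,∞]`, the crux for one potential is
  EXACTLY `∀ κ > 0, ∃ ρ₀ > 0, irConstant v κ ρ₀ < ⊤` (`irConstant_le_of_ground`,
  `ground_of_irConstant_lt_top`, `irConstant_mono`): no slack, no state quantifier, no constant — one
  extended real number per `(v, κ, ρ₀)`. Bogoliubov predicts `lim_{ρ₀→0} irConstant v κ ρ₀ ≈ √a·O(1)`,
  independent of `κ`.
-/

noncomputable section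

open MeasureTheory Filter
open scoped ENNReal NNReal ComplexConjugate BigOperators
namespace Summit.AtomisticToContinuum.BoseEinsteinCondensation.Theorems.PeriodicIRBound.Negative

open Literature.MathematicalPhysics.QuantumManyBody.BoseGas
open Summit.AtomisticToContinuum.BoseEinsteinCondensation.Theses.BECGroundStateSOS
open Summit.AtomisticToContinuum.BoseEinsteinCondensation.Theorems.GaussianDominationCan.Negative
  (symState symFun oneBody periodicEnergy_symState nsq nsq_nonneg e0 e0_ne_zero norm_e0
    nsq_e0 one_le_norm_intVec isRepulsiveFiniteRange_zero)
open Summit.AtomisticToContinuum.BoseEinsteinCondensation.Theorems.CorrectorClosure.Negative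
  (hardCore isRepulsiveFiniteRange_hardCore periodicEnergy_hardCore_eq_top
    periodicGroundStateEnergy_one_eq_top)

variable {L : ℝ} {m : ℕ} {n : Fin 3 → ℤ} {a b : ℝ}

/-! ## §18 SCALARISATION: the crux for `v` is the finiteness of the infrared constants -/

/-- The **normalised infrared profile** of the ground state at `(ρ, N)`: the largest value over the
window of `γ_N(k) · ‖k‖_∞/(√ρ L_N)` (`γ_N` = `groundOccupation`, the worst near-ground occupation
as the slack `δ ↓ 0`). Bogoliubov: `≈ √(πa)/(2π)` at the bottom of the window, smaller above. -/
def irRatio (v : ℝ → ℝ≥0∞) (κ ρ : ℝ) (N : ℕ) : ℝ≥0∞ :=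
  ⨆ (k : Fin 3 → ℤ) (_ : InWindow κ ρ N k),
    groundOccupation v N (sideLength ρ N) k *
      ENNReal.ofReal (‖(fun j => (k j : ℝ))‖ / (Real.sqrt ρ * sideLength ρ N))

/-- The **infrared constant** of `v` in the window `κ` below density `ρ₀`:
`sup_{0<ρ<ρ₀} limsup_{N→∞} irRatio v κ ρ N ∈ [0, ∞]`. -/
def irConstant (v : ℝ → ℝ≥0∞) (κ ρ₀ : ℝ) : ℝ≥0∞ :=
  ⨆ (ρ : ℝ) (_ : 0 < ρ ∧ ρ < ρ₀), limsup (irRatio v κ ρ) atTop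

/-- `irConstant` is monotone in `ρ₀`. [folklore] -/
theorem irConstant_mono {v : ℝ → ℝ≥0∞} {κ ρ₀ ρ₀' : ℝ} (h : ρ₀' ≤ ρ₀) :
    irConstant v κ ρ₀' ≤ irConstant v κ ρ₀ :=
  iSup₂_le fun ρ hρ => le_iSup₂_of_le (f := fun (ρ : ℝ) (_ : 0 < ρ ∧ ρ < ρ₀) =>
    limsup (irRatio v κ ρ) atTop) ρ ⟨hρ.1, hρ.2.trans_le h⟩ le_rfl

/-- A ground-state infrared bound with constant `C` bounds the infrared constant by `C`. [folklore] -/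
theorem irConstant_le_of_ground {v : ℝ → ℝ≥0∞} {κ ρ₀ C : ℝ} (h : GroundIRBoundWith v κ ρ₀ C) :
    irConstant v κ ρ₀ ≤ ENNReal.ofReal C := by
  refine iSup₂_le fun ρ hρ => Filter.limsup_le_of_le (h := ?_)
  filter_upwards [h ρ hρ.1 hρ.2, eventually_gt_atTop 0] with N hN hNpos
  have hL := sideLength_pos_of_pos hρ.1 hNpos
  have hsL : 0 < Real.sqrt ρ * sideLength ρ N := mul_pos (Real.sqrt_pos.2 hρ.1) hL
  refine iSup₂_le fun k hk => ?_
  have hn : 0 < ‖(fun j => (k j : ℝ))‖ := lt_of_lt_of_le one_pos (one_le_norm_intVec hk.1)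
  have hq : 0 ≤ ‖(fun j => (k j : ℝ))‖ / (Real.sqrt ρ * sideLength ρ N) := by positivity
  have hsq : Real.sqrt ρ ≠ 0 := (Real.sqrt_pos.2 hρ.1).ne'
  calc groundOccupation v N (sideLength ρ N) k *
        ENNReal.ofReal (‖(fun j => (k j : ℝ))‖ / (Real.sqrt ρ * sideLength ρ N))
      ≤ ENNReal.ofReal (C * Real.sqrt ρ * sideLength ρ N / ‖(fun j => (k j : ℝ))‖) *
        ENNReal.ofReal (‖(fun j => (k j : ℝ))‖ / (Real.sqrt ρ * sideLength ρ N)) := by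
        gcongr
        exact hN k hk
    _ = ENNReal.ofReal C := by
        rw [← ENNReal.ofReal_mul' hq]
        congr 1
        field_simp

/-- **A finite infrared constant IS a ground-state infrared bound** (constant `irConstant.toReal + 1`):
`limsup < C` gives `irRatio < C` eventually, and dividing by the positive finite factor
`‖k‖/(√ρ L_N)` returns the crux's shape. [folklore] -/
theorem ground_of_irConstant_lt_top {v : ℝ → ℝ≥0∞} {κ ρ₀ : ℝ} (h : irConstant v κ ρ₀ < ⊤) :
    ∃ C : ℝ, 0 < C ∧ GroundIRBoundWith v κ ρ₀ C := by
  set S := irConstant v κ ρ₀ with hS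
  have hStop : S ≠ ⊤ := h.ne
  refine ⟨S.toReal + 1, by positivity, fun ρ hρ hρρ₀ => ?_⟩
  have hC : S < ENNReal.ofReal (S.toReal + 1) := by
    rw [ENNReal.ofReal_add ENNReal.toReal_nonneg zero_le_one, ENNReal.ofReal_toReal hStop,
      ENNReal.ofReal_one]
    exact ENNReal.lt_add_right hStop one_ne_zero
  have hlim : limsup (irRatio v κ ρ) atTop < ENNReal.ofReal (S.toReal + 1) :=
    lt_of_le_of_lt (le_iSup₂_of_le (f := fun (ρ : ℝ) (_ : 0 < ρ ∧ ρ < ρ₀) =>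
      limsup (irRatio v κ ρ) atTop) ρ ⟨hρ, hρρ₀⟩ le_rfl) hC
  filter_upwards [Filter.eventually_lt_of_limsup_lt hlim, eventually_gt_atTop 0] with N hN hNpos k hk
  have hL := sideLength_pos_of_pos hρ hNpos
  have hsL : 0 < Real.sqrt ρ * sideLength ρ N := mul_pos (Real.sqrt_pos.2 hρ) hL
  have hn : 0 < ‖(fun j => (k j : ℝ))‖ := lt_of_lt_of_le one_pos (one_le_norm_intVec hk.1)
  set q : ℝ := ‖(fun j => (k j : ℝ))‖ / (Real.sqrt ρ * sideLength ρ N) with hqdef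
  have hq : 0 < q := by positivity
  have hr0 : ENNReal.ofReal q ≠ 0 := (ENNReal.ofReal_pos.2 hq).ne'
  have hrtop : ENNReal.ofReal q ≠ ⊤ := ENNReal.ofReal_ne_top
  have hk_le : groundOccupation v N (sideLength ρ N) k * ENNReal.ofReal q ≤
      ENNReal.ofReal (S.toReal + 1) :=
    (le_iSup₂_of_le (f := fun (k : Fin 3 → ℤ) (_ : InWindow κ ρ N k) =>
      groundOccupation v N (sideLength ρ N) k *
        ENNReal.ofReal (‖(fun j => (k j : ℝ))‖ / (Real.sqrt ρ * sideLength ρ N))) k hk le_rfl).trans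
      hN.le
  calc groundOccupation v N (sideLength ρ N) k
      = groundOccupation v N (sideLength ρ N) k * ENNReal.ofReal q / ENNReal.ofReal q :=
        (ENNReal.mul_div_cancel_right hr0 hrtop).symm
    _ ≤ ENNReal.ofReal (S.toReal + 1) / ENNReal.ofReal q := ENNReal.div_le_div_right hk_le _
    _ = ENNReal.ofReal ((S.toReal + 1) / q) := (ENNReal.ofReal_div_of_pos hq).symm
    _ = ENNReal.ofReal ((S.toReal + 1) * Real.sqrt ρ * sideLength ρ N / ‖(fun j => (k j : ℝ))‖) := by
        congr 1
        rw [hqdef]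
        field_simp

/-- **The crux for one potential is the finiteness of its infrared constants**:
`IRBoundFor v ↔ ∀ κ > 0, ∃ ρ₀ > 0, irConstant v κ ρ₀ < ⊤`, i.e. (monotonicity in `ρ₀`)
`limsup_{ρ→0⁺} limsup_{N→∞} max_{0<‖k‖_∞≤κ√ρL_N} ‖k‖_∞ γ_N(k)/(√ρ L_N) < ∞` for every window `κ`.
This is the sharpest form for provers: no slack, no state, no `C` — one extended real per
`(v, κ, ρ₀)`; Bogoliubov predicts the limit `≈ √(a(v))·(geometric factor)`, INDEPENDENT of `κ`.
[folklore] -/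
theorem irBoundFor_iff_irConstant (v : ℝ → ℝ≥0∞) :
    IRBoundFor v ↔ ∀ κ : ℝ, 0 < κ → ∃ ρ₀ : ℝ, 0 < ρ₀ ∧ irConstant v κ ρ₀ < ⊤ := by
  rw [irBoundFor_iff_ground]
  constructor
  · intro h κ hκ
    obtain ⟨ρ₀, hρ₀, C, _hC, h⟩ := h κ hκ
    exact ⟨ρ₀, hρ₀, (irConstant_le_of_ground h).trans_lt ENNReal.ofReal_lt_top⟩
  · intro h κ hκ
    obtain ⟨ρ₀, hρ₀, h⟩ := h κ hκ
    exact ⟨ρ₀, hρ₀, ground_of_irConstant_lt_top h⟩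

end Summit.AtomisticToContinuum.BoseEinsteinCondensation.Theorems.PeriodicIRBound.Negative

end
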